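import Summits.ResolutionOfSingularities.ResolutionOfSingularities.Theorems.FrobeniusLadderFInjectiveMacaulayficationDominatingLocFixRegular
import Summits.ResolutionOfSingularities.ResolutionOfSingularities.Theorems.FrobeniusLadderFInjectiveMacaulayficationDominatingLocFix
import Summits.ResolutionOfSingularities.ResolutionOfSingularities.Theorems.FrobeniusLadderFInjectiveMacaulayficationLocFixFullAtNonClosedLowDim
import Literature.AlgebraicGeometry.Resolution.BlowupsScaling
import Literature.AlgebraicGeometry.Resolution.BlowupChartRsop
import Literature.AlgebraicGeometry.Resolution.IdealSheafLemmas
import Literature.AlgebraicGeometry.Resolution.Temkin2008OfHironaka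
import Literature.AlgebraicGeometry.Resolution.GeneralLU
import Literature.AlgebraicGeometry.Resolution.GeneralLUProofs
import Literature.AlgebraicGeometry.Resolution.QuasiExcellentSchemes
import Literature.AlgebraicGeometry.Resolution.ExcellentRingsFieldProofs
import HarnessLib

/-!
# The product-compatible REGULAR local fix at a point of local dimension three, and the dominating cure it yields
# (crux `FInjectiveMacaulayfication` stmt-ResolutionOfSingularities-15315, chain w45a; res-L1-w45a-plan-1 RULING R16.43 (b)
# `exists_productCompatible_locFix_lowDim` — local half (b2) at `dim 𝒪_ζ = 3` — and (c) assembled; seat res-L1-w45a-stub-1 g6)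

[OURS · L1 W4.5a] Support file (`--supports stmt-ResolutionOfSingularities-15315 --as helper`); NOT a statement of any manuscript; def-free;
THEOREMS modulo printed results taken BY NAME as hypotheses (`CossartPiltant2019General`, `Stacks081R`, `CossartPiltant2019Principalization`;
for the cure also `NonFullLocusClosed` = Datta–Murayama 2024 Thm. B + EGA IV₂ 6.11.2); AI-written (AI review is weaker than expert review).

* `exists_productCompatible_locFix_dimThree (hG h081R hP)`: `X₁` an integral `k`-scheme locally of finite type (`char k = p`), `ζ ∈ X₁` with
  `dim 𝒪_{X₁,ζ} = 3`, `J₀ ≠ ⊥` an ideal sheaf. Then there are germs `c` at `ζ` with `(c) ≠ ⊥` and generators `d` of the PRODUCT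
  `J₀,ζ · (c)` such that EVERY prime of EVERY affine blow-up chart `𝒪_{X₁,ζ}[(d)/d_j]` has a REGULAR — hence FULL — local ring. Proof:
  `S := Spec 𝒪_{X₁,ζ}` is an integral Noetherian affine quasi-excellent scheme of dimension `3` (local rings of varieties are quasi-excellent:
  `Stacks07QW_field_holds`, `isQuasiExcellentRing_stalk`, `Stacks07QU_holds`); apply the scheme-level product-compatible resolution
  `DominatingLocFixRegular.exists_isBlowup_mul_isRegular_of_dim_three` to `J := (J₀,ζ)~`; the factor `𝔟` is `𝔮~` for an ideal `𝔮 ⊆ 𝒪_ζ`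
  (ideal sheaves on an affine scheme are ideals of the global sections), `(J₀,ζ)~ · 𝔮~ = (J₀,ζ 𝔮)~ = (d)~`, so the affine blowing up
  `Bl_{(d)} S = Proj 𝒪_ζ[(d)t]` is regular; a prime `𝔔` of the chart `𝒪_ζ[(d)/d_j]` is a point of the chart `Spec (𝒪_ζ[(d)t])_{(d_j t)}`
  (`reesChartEquiv`, `affineBlowup.chartι`), whose local ring is `(𝒪_ζ[(d)/d_j])_𝔔`; regular ⇒ FULL (`FiClauseOfRegular`).
* `exists_dominating_cure_dimThree (hG h081R hP hNF)`: under the binders of the (A′) route, at `ζ` of local dimension `3` and for any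
  partial cure `J₀ ≠ ⊥` there are `J″ ≠ ⊥` and an open `U ∋ ζ` with every blowing up along `J₀ · J″` FULL over `U` and
  `GoodOver p X₁ (J₀ * J″) U` — (b2) fed into `DominatingLocFix.exists_dominating_goodOver_nhd`. Local dimension `≤ 2` is NOT covered here
  (no dimension-2 principalization fact is typed in the tree; dimension `1` would be elementary) — flagged to the planner.
[cite: CossartPiltant2019, Thm. 1.1 (i)(ii); Prop. 4.4] [cite: StacksProject, Tag 0804; Tag 080A; Tag 080B; Tag 07QU]
[cite: Matsumura1987, Thm. 17.4] [cite: Kunz1969, Thm. 2.1] [cite: DattaMurayama2024, Thm. B]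
-/

-- single-problem summit: the doubled namespace component is forced
set_option linter.dupNamespace false

noncomputable section

namespace Summit.ResolutionOfSingularities.ResolutionOfSingularities.Theorems.FInjectiveMacaulayfication.DominatingLocFixLocal

open CategoryTheory CategoryTheory.Limits AlgebraicGeometry TopologicalSpace IsLocalRing
open Literature.AlgebraicGeometry.Resolution
open Summit.ResolutionOfSingularities.ResolutionOfSingularities.Theorems.FInjectiveMacaulayfication
open SliceableCentre FCUnguardedAprime

set_option maxHeartbeats 800000 in
-- instance unification on the Rees chart ring `chartRing d j` is slow (as in `BlowupAlgebraPrimesPoints.lean`)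
/-- **(b2) The product-compatible REGULAR local blow-up at a point of local dimension three.** For `J₀ ≠ ⊥` and `ζ ∈ X₁` with
`dim 𝒪_{X₁,ζ} = 3` there are germs `c` with `(c) ≠ ⊥` and generators `d` of `J₀,ζ · (c)` all of whose affine blow-up charts `𝒪_ζ[(d)/d_j]`
are REGULAR and FULL at EVERY prime — modulo CP 2019 Thm. 1.1, Raynaud–Gruson flattening and CP 2019 Prop. 4.4 BY NAME.
[OURS · conditional-result] [cite: CossartPiltant2019, Thm. 1.1 (i)(ii); Prop. 4.4] [cite: StacksProject, Tag 0804] -/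
theorem exists_productCompatible_locFix_dimThree
    (hG : CossartPiltant2019General.{0}) (h081R : Stacks081R.{0}) (hP : CossartPiltant2019Principalization.{0})
    (p : ℕ) [hp : Fact p.Prime] {k : Type} [Field k] [CharP k p] {X₁ : Scheme.{0}} (f₁ : X₁ ⟶ Spec (.of k))
    [LocallyOfFiniteType f₁] [IsIntegral X₁]
    (ζ : X₁) (hdim : ringKrullDim (X₁.presheaf.stalk ζ) = 3) (J₀ : X₁.IdealSheafData) (hJ₀ : J₀ ≠ ⊥) :
    ∃ (m : ℕ) (c : Fin m → X₁.presheaf.stalk ζ) (n : ℕ) (d : Fin n → X₁.presheaf.stalk ζ),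
      Ideal.span (Set.range c) ≠ ⊥ ∧ Ideal.span (Set.range d) = stalkIdeal J₀ ζ * Ideal.span (Set.range c) ∧
      ∀ (j : Fin n) (𝔔 : PrimeSpectrum (blowupAlgebra (Ideal.span (Set.range d)) (d j))),
        IsRegularLocalRing (Localization.AtPrime 𝔔.asIdeal) ∧ FullCl p (Localization.AtPrime 𝔔.asIdeal) := by
  classical
  haveI : IsLocallyNoetherian X₁ := LocallyOfFiniteType.isLocallyNoetherian f₁
  -- `S := Spec 𝒪_{X₁,ζ}`: integral, Noetherian, affine (separated), quasi-excellent, of dimension `3`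
  have hqX : Scheme.IsQuasiExcellent X₁ := Scheme.isQuasiExcellent_of_locallyOfFiniteType Stacks07QW_field_holds f₁
  have hqR : IsQuasiExcellentRing (X₁.presheaf.stalk ζ) := hqX.isQuasiExcellentRing_stalk ζ
  have hqe : Scheme.IsQuasiExcellent (Spec (.of (X₁.presheaf.stalk ζ))) :=
    Scheme.isQuasiExcellent_of_locallyOfFiniteType_of_isQuasiExcellentRing Stacks07QU_holds hqR (𝟙 _)
  have hdimS : topologicalKrullDim (Spec (.of (X₁.presheaf.stalk ζ))) = 3 := by
    change topologicalKrullDim (PrimeSpectrum (X₁.presheaf.stalk ζ)) = 3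
    rw [PrimeSpectrum.topologicalKrullDim_eq_ringKrullDim, hdim]
  have hI₀ : stalkIdeal J₀ ζ ≠ ⊥ := stalkIdeal_ne_bot_of_ne_bot hJ₀ ζ
  -- the scheme-level product-compatible resolution applied to `(J₀,ζ)~`
  obtain ⟨𝔟, h𝔟, -, hall⟩ := DominatingLocFixRegular.exists_isBlowup_mul_isRegular_of_dim_three hG h081R hP hqe hdimS
    (affineBlowup.idealSheaf (stalkIdeal J₀ ζ)) (affineBlowup.idealSheaf_ne_bot hI₀)
  -- `𝔟 = 𝔮~` for the ideal `𝔮` of `𝒪_ζ` of its global sections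
  let eΓ := Scheme.ΓSpecIso (.of (X₁.presheaf.stalk ζ))
  let 𝔮 : Ideal (X₁.presheaf.stalk ζ) := (𝔟.ideal ⟨⊤, isAffineOpen_top _⟩).map eΓ.hom.hom
  have hcomp : eΓ.inv.hom.comp eΓ.hom.hom = RingHom.id _ := by
    rw [← CommRingCat.hom_comp, Iso.hom_inv_id, CommRingCat.hom_id]
  have h𝔮map : 𝔮.map eΓ.inv.hom = 𝔟.ideal ⟨⊤, isAffineOpen_top _⟩ := by
    rw [Ideal.map_map, hcomp, Ideal.map_id]
  have h𝔟eq : affineBlowup.idealSheaf 𝔮 = 𝔟 := by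
    apply Scheme.IdealSheafData.ext_of_isAffine
    rw [affineBlowup.idealSheaf, ideal_ofIdealTop_top, h𝔮map]
  have h𝔮0 : 𝔮 ≠ ⊥ := by
    intro h0
    apply h𝔟
    rw [← h𝔟eq, h0]
    apply Scheme.IdealSheafData.ext_of_isAffine
    rw [affineBlowup.idealSheaf, ideal_ofIdealTop_top, Ideal.map_bot, Scheme.IdealSheafData.ideal_bot, Pi.bot_apply]
  have hprod : affineBlowup.idealSheaf (stalkIdeal J₀ ζ) * 𝔟 = affineBlowup.idealSheaf (stalkIdeal J₀ ζ * 𝔮) := by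
    rw [affineBlowup.idealSheaf_mul, h𝔟eq]
  -- generators `c` of `𝔮` and `d` of `J₀,ζ · 𝔮`
  obtain ⟨m, c, hc⟩ := Submodule.fg_iff_exists_fin_generating_family.mp (IsNoetherian.noetherian 𝔮)
  obtain ⟨n, d, hd⟩ := Submodule.fg_iff_exists_fin_generating_family.mp (IsNoetherian.noetherian (stalkIdeal J₀ ζ * 𝔮))
  have hc' : Ideal.span (Set.range c) = 𝔮 := hc
  have hd' : Ideal.span (Set.range d) = stalkIdeal J₀ ζ * 𝔮 := hd
  -- the affine blowing up `Bl_{(d)} Spec 𝒪_ζ` is a blowing up along `(J₀,ζ)~ · 𝔟`, hence regular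
  have hreg : Scheme.IsRegular (affineBlowup (Ideal.span (Set.range d))) := by
    refine hall _ (affineBlowup.π (Ideal.span (Set.range d))) ?_
    rw [hprod, ← hd']
    exact affineBlowup.isBlowup _
  refine ⟨m, c, n, d, by rw [hc']; exact h𝔮0, by rw [hd', hc'], fun j 𝔔 => ?_⟩
  -- the prime `𝔔` of the chart `𝒪_ζ[(d)/d_j]` is a point `x′` of the chart `Spec (𝒪_ζ[(d)t])_{(d_j t)} ⊆ Bl_{(d)} Spec 𝒪_ζ`
  have hdj : ∀ j, d j ∈ Ideal.span (Set.range d) := fun j => Ideal.mem_span_range_self (f := d) (x := j)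
  set ε : chartRing d j ≃+* blowupAlgebra (Ideal.span (Set.range d)) (d j) :=
    reesChartEquiv (I := Ideal.span (Set.range d)) (d j) (hdj j) with hεdef
  let w : Spec (.of (chartRing d j)) :=
    ⟨𝔔.asIdeal.comap (ε : chartRing d j →+* _), Ideal.comap_isPrime (ε : chartRing d j →+* _) 𝔔.asIdeal⟩
  have hmemw : ∀ b : chartRing d j, ε b ∈ 𝔔.asIdeal ↔ b ∈ w.asIdeal := fun b => Iff.rfl
  haveI : IsIso ((affineBlowup.chartι (I := Ideal.span (Set.range d)) (d j) (hdj j)).stalkMap w) := inferInstance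
  haveI := w.2
  haveI := 𝔔.2
  obtain ⟨e3⟩ := BlowupFiModelOfCover.nonempty_ringEquiv_localization_of_ringEquiv ε w.asIdeal 𝔔.asIdeal hmemw
  have e : (affineBlowup (Ideal.span (Set.range d))).presheaf.stalk
      ((affineBlowup.chartι (I := Ideal.span (Set.range d)) (d j) (hdj j)) w) ≃+* Localization.AtPrime 𝔔.asIdeal :=
    ((asIso ((affineBlowup.chartι (I := Ideal.span (Set.range d)) (d j) (hdj j)).stalkMap w)).commRingCatIsoToRingEquiv.trans
      (Spec.stalkIso (.of (chartRing d j)) w).commRingCatIsoToRingEquiv).trans e3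
  -- regular, of characteristic `p`, hence FULL
  have hregx : IsRegularLocalRing ((affineBlowup (Ideal.span (Set.range d))).presheaf.stalk
      ((affineBlowup.chartι (I := Ideal.span (Set.range d)) (d j) (hdj j)) w)) := hreg _
  have hreg𝔔 : IsRegularLocalRing (Localization.AtPrime 𝔔.asIdeal) := by
    haveI := hregx
    exact IsRegularLocalRing.of_ringEquiv e
  haveI : CharP (Localization.AtPrime 𝔔.asIdeal) p :=
    CharP.of_ringHom_of_ne_zero
      ((algebraMap (blowupAlgebra (Ideal.span (Set.range d)) (d j)) (Localization.AtPrime 𝔔.asIdeal)).comp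
        ((algebraMap (X₁.presheaf.stalk ζ) (blowupAlgebra (Ideal.span (Set.range d)) (d j))).comp
          ((X₁.presheaf.germ ⊤ ζ trivial).hom.comp (f₁.appTop.hom.comp (Scheme.ΓSpecIso (.of k)).inv.hom))))
      p hp.out.ne_zero
  haveI := hreg𝔔
  exact ⟨hreg𝔔, FiClauseOfRegular.stub_fiClauseOfRegular p _⟩

/-- **(c) at local dimension three, assembled: the DOMINATING CURE `J₀ · J″` near `ζ`.** Under the binders of the (A′) route, for a partial
cure `J₀ ≠ ⊥` and a point `ζ` with `dim 𝒪_{X₁,ζ} = 3` there are `J″ ≠ ⊥` and an open `U ∋ ζ` such that every blowing up of `X₁` along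
`J₀ · J″` is FULL at every point over `U`; in particular `GoodOver p X₁ (J₀ * J″) U`. Off `supp J″` the centre `J₀ · J″` IS `J₀`.
Modulo CP 2019 Thm. 1.1 + Raynaud–Gruson + CP 2019 Prop. 4.4 (the regular product-compatible local blow-up) and `NonFullLocusClosed`
(Datta–Murayama Thm. B + EGA IV₂ 6.11.2) BY NAME. [OURS · conditional-result]
[cite: CossartPiltant2019, Thm. 1.1 (i)(ii); Prop. 4.4] [cite: DattaMurayama2024, Thm. B] [cite: StacksProject, Tag 0804] -/
theorem exists_dominating_cure_dimThree
    (hG : CossartPiltant2019General.{0}) (h081R : Stacks081R.{0}) (hP : CossartPiltant2019Principalization.{0})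
    (hNF : NonFullLocusClosed.NonFullLocusClosed)
    (p : ℕ) (hp : p.Prime) (k : Type) [Field k] [CharP k p] (X₁ : Scheme.{0}) (f₁ : X₁ ⟶ Spec (.of k))
    [LocallyOfFiniteType f₁] [QuasiCompact f₁] [IsIntegral X₁]
    (J₀ : X₁.IdealSheafData) (hJ₀ : J₀ ≠ ⊥) (ζ : X₁) (hdim : ringKrullDim (X₁.presheaf.stalk ζ) = 3) :
    ∃ (J'' : X₁.IdealSheafData) (U : X₁.Opens), J'' ≠ ⊥ ∧ ζ ∈ (U : Set X₁) ∧
      (∀ (X₂ : Scheme.{0}) (π : X₂ ⟶ X₁), IsBlowup π (J₀ * J'') → ∀ x : X₂, π.base x ∈ (U : Set X₁) → FullCl p (X₂.presheaf.stalk x)) ∧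
      GoodOver p X₁ (J₀ * J'') (U : Set X₁) := by
  haveI : Fact p.Prime := ⟨hp⟩
  obtain ⟨m, c, n, d, hc0, hd, hfull⟩ := exists_productCompatible_locFix_dimThree hG h081R hP p f₁ ζ hdim J₀ hJ₀
  obtain ⟨J'', U, hJ'', -, hζU, hU, hgood⟩ := DominatingLocFix.exists_dominating_goodOver_nhd hNF p hp k X₁ f₁ J₀ hJ₀ ζ c hc0 d hd
    (fun j 𝔔 _ => (hfull j 𝔔).2)
  exact ⟨J'', U, hJ'', hζU, hU, hgood⟩

/-- (c) at local dimension three from the FIVE printed theorems BY NAME (CP 2019 Thm. 1.1; Raynaud–Gruson 1971 Thm. 5.2.2; CP 2019 Prop. 4.4;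
Datta–Murayama 2024 Thm. B; openness of the Cohen–Macaulay locus EGA IV₂ 6.11.2). [OURS · conditional-result] -/
theorem exists_dominating_cure_dimThree_of_named
    (hG : CossartPiltant2019General.{0}) (h081R : Stacks081R.{0}) (hP : CossartPiltant2019Principalization.{0})
    (hDM : Literature.AlgebraicGeometry.Resolution.DattaMurayama2024_fInjectiveLocusOpen.{0})
    (hCMo : NonFullLocusClosed.CMLocusOpen)
    (p : ℕ) (hp : p.Prime) (k : Type) [Field k] [CharP k p] (X₁ : Scheme.{0}) (f₁ : X₁ ⟶ Spec (.of k))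
    [LocallyOfFiniteType f₁] [QuasiCompact f₁] [IsIntegral X₁]
    (J₀ : X₁.IdealSheafData) (hJ₀ : J₀ ≠ ⊥) (ζ : X₁) (hdim : ringKrullDim (X₁.presheaf.stalk ζ) = 3) :
    ∃ (J'' : X₁.IdealSheafData) (U : X₁.Opens), J'' ≠ ⊥ ∧ ζ ∈ (U : Set X₁) ∧
      (∀ (X₂ : Scheme.{0}) (π : X₂ ⟶ X₁), IsBlowup π (J₀ * J'') → ∀ x : X₂, π.base x ∈ (U : Set X₁) → FullCl p (X₂.presheaf.stalk x)) ∧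
      GoodOver p X₁ (J₀ * J'') (U : Set X₁) :=
  exists_dominating_cure_dimThree hG h081R hP (NonFullLocusClosed.nonFullLocusClosed_of_named hDM hCMo) p hp k X₁ f₁ J₀ hJ₀ ζ hdim

end Summit.ResolutionOfSingularities.ResolutionOfSingularities.Theorems.FInjectiveMacaulayfication.DominatingLocFixLocal

end
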